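import Summits.ResolutionOfSingularities.ResolutionOfSingularities.Theorems.JetCutKernels2
import Summits.ResolutionOfSingularities.ResolutionOfSingularities.Theorems.JetCutTameClasses
import HarnessLib

/-!
# JetCutTameKernels — decomp-res node «JetCut» (lens-2 g15 rev 5), file 1/2 of `JetCutTameKernels`

Content VERBATIM from the decomp-res lens-2 file `HOME/decomp-res-lens-2/g15/JetCut.lean` rev 5 (pin 9f53e5ca =
`parts/JetCut-rev5-9f53e5ca.lean`, 7 495 l;
HOME = run/shared/lean/pub/decomp-res; CRITIC-LEDGER rows 109 / 115 / 120 / 121 / 122 / 127 / 133 CLEARED; landing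
order INBOX :231; the critic's
HYGIENE-landing.md h1–h11 applied — DOCSTRING-ONLY).  The lens's blocks RESTATED VERBATIM from lens-2 g12 / g13 /
g14 (§R / §R13 / §R14) are DELETED:
they are the tree's `RelativeDeltaCut*` / `CurveLeafExit*` / `PinchCut*` modules (namespaces `RelativeDeltaCut`,
`CurveLeafExit`, `PinchCut`, opened;
the lens's `CurveLeafExitRestated.x` / `PinchCutRestated.x` are cited as `CurveLeafExit.x` / `PinchCut.x`, the three
pointwise engine edges of g12 as
`RelativeDeltaCut.x`).  Namespace `…Theorems.JetCut` (the lens's `Theses.JetCut` is gate-reserved), sub-namespaces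
`Tame` / `Wide` / `Broad` / `Vast`
as in the lens; file split only (tree files ≤ 400 lines): sections, variables and every declaration exactly as in
the lens, the long rev-0/1 prose
lives in HOME/decomp-res-lens-2/g15/NODE-g15.md §ARCHIVE-A (not in the tree).  Node files, in import order:
`JetCutJetKernels`, `JetCutPoint`, `JetCutClasses`, `JetCutKernels`, `JetCutTame`, `JetCutTameClasses`,
`JetCutTameKernels`, `JetCutLadder`, `JetCutWideClasses`, `JetCutWideKernels`, `JetCutMixed`, `JetCutBroadClasses`,
`JetCutBroadKernels`, `JetCutDegenerate`, `JetCutVastClasses`, `JetCutVastKernels`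
(each possibly continued `…2`, `…3`), then the wiring `MaxContactCutJetCut*` (in the Theses cone).  All `--supports
stmt-ResolutionOfSingularities-29273`
(`MaxContactCut.RungOne`); nothing closes 29273 — decided cells carry their engines as hypotheses, and exactly ONE
located-residual aside is booked on
the route for this column (`Vast.VastSpecialRung`, home `JetCutVastClasses`).

§TK (namespace `Tame`) + the route-free refinement edges tame → jet: pure-logic KERNELS of the TAME cut (mechanical
copy of §K: exhaustion, projections, EXACT `Tame.seqDimFour_one_iff`, strata cuts, engine kernels at a point,
`Tame.tGenRungAt_of_engines`, `Tame.tameGenericRung_of_engines`, `flatConeExit_of_jetTameExit`) — VERBATIM, 0 sorry;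
`Tame.rungOne_iff` / `Tame.closes*` / edges naming route items are in `MaxContactCutJetCut*`.  [Writer: the lens's
two mechanical re-proofs `Tame.isCurveExitPt_of_isJetTameCurvePt` / `Tame.not_isTameSpecialPt_of_isJetTameCurvePt` —
the SAME statements as the §T2 originals in the enclosing namespace — are not repeated (the gate's dedup.landed lint
forbids restating a landed declaration); every use resolves to the original by namespace resolution, proofs unchanged.]

Part 1/2 carries: `not_gen_of_isTameSpecialPt`, `isPinchSpecialPt_of_isTameSpecialPt`,
`isLeafSpecialPt_of_isTameSpecialPt`, `isRelSpecialPt_of_isTameSpecialPt`, `isNearSpecialPt_of_isTameSpecialPt`,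
`isFaceSpecialPt_of_isTameSpecialPt`, `isDeltaSpecialPt_of_isTameSpecialPt`, `seqDimFour_one_iff`,
`seqDimFour_one_of_tgen_tspec`, `seqTGen_of_seqDimFour_one`, `seqTSpec_of_seqDimFour_one`,
`seqDimFour_two_of_seqTGen`, `seqPGen_of_seqTGen`, `seqLGen_of_seqTGen`, `seqRGen_of_seqTGen`, `seqNGen_of_seqTGen`,
`seqDGen_of_seqTGen`, `seqTSpec_of_seqPSpec`, `seqTSpec_of_seqLSpec`, `seqTSpec_of_seqRSpec`,
`seqTSpec_of_seqNSpec`, `seqTSpec_of_seqDSpec`, `seqTSpecNonIso_of_seqPSpecNonIso`,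
`seqTSpecNonIso_of_seqDSpecNonIso`, `seqTSpecCurve_of_seqPSpecCurve`, `seqTSpecCurve_of_seqLSpecCurve`,
`seqTSpecCurveReg_of_seqPSpecCurveReg`, `seqTSpec_iff_iso`, `seqTSpec_of_iso`, `seqTSpecNonIso_iff`,
`seqTSpecNonIso_of_strata`, `seqTSpecCurve_iff_reg`, `seqTSpecCurve_of_centres`, `seqTSpec_of_leaves`,
`isCurveExitPt_of_isConeTailCurvePt`, `tGenRungAt_of_engines`, `tGenRungAt_one`, `tameGenericRung_of_engines`,
`tameSpecialRung_iff_iso`, `tameSpecialRung_iff_leaves`, `e_one_iff_families`.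

(Sources: HunekeSwanson2006 Cor. 5.5.5; CossartJannsenSaito2020 Ch. 2, Thm. 3.6/3.7, Ch. 8; CossartPiltant2008 Prop.
4.2; CossartPiltant2019 Rem. 3.2; Hironaka1964 Ch. III; Hironaka1967; Hironaka1977; Moh1987; Giraud1975.)
-/

open CategoryTheory AlgebraicGeometry TopologicalSpace IsLocalRing
open Literature.AlgebraicGeometry.Resolution
open Summit.ResolutionOfSingularities.ResolutionOfSingularities.Theorems
open Summit.ResolutionOfSingularities.ResolutionOfSingularities.Theorems.WeakOrderReduction
open Summit.ResolutionOfSingularities.ResolutionOfSingularities.Theorems.DeltaFaceCutClasses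
open Summit.ResolutionOfSingularities.ResolutionOfSingularities.Theorems.RelativeDeltaCut
open Summit.ResolutionOfSingularities.ResolutionOfSingularities.Theorems.CurveLeafExit
open Summit.ResolutionOfSingularities.ResolutionOfSingularities.Theorems.PinchCut

namespace Summit.ResolutionOfSingularities.ResolutionOfSingularities.Theorems.JetCut

namespace Tame

section Kernels

variable {n : ℕ}

/-- A tame-special point is in none of the nine decided classes. [folklore] -/
theorem not_gen_of_isTameSpecialPt {k : Type} [Field k] {Y : Scheme.{0}} {g : Y ⟶ Spec (.of k)}
    {hY : Scheme.IsRegular Y} {I : Y.IdealSheafData} {n : ℕ} {y : Y} (h : IsTameSpecialPt g hY I n y) :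
    ¬ (ClassGE g hY I n 2 y ∨ VeryNearCutClasses.IsNearGenericPt I n y ∨ IsDeltaGenericPt I n y ∨
        IsCurveGenericPt I n y ∨ IsRelCurveGenericPt I n y ∨ IsFlatCurvePt I n y ∨
        IsPinchCurvePt I n y ∨ IsConeCurvePt I n y ∨ IsJetTameCurvePt I n y) := by
  rintro (hc | hg | hd | hu | hr | hf | hm | hC | hT)
  · exact h.1.1.1.1.1 hc
  · exact h.1.1.1.1.2 hg
  · exact h.1.1.1.2.1 hd
  · exact h.1.1.1.2.2 hu
  · exact h.1.1.2.1 hr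
  · exact h.1.1.2.2 hf
  · exact h.1.2.1 hm
  · exact h.1.2.2 hC
  · exact h.2 hT

/-- A tame-special point is pinch-special (g14, restated) — projection. [folklore] -/
theorem isPinchSpecialPt_of_isTameSpecialPt {k : Type} [Field k] {Y : Scheme.{0}} {g : Y ⟶ Spec (.of k)}
    {hY : Scheme.IsRegular Y} {I : Y.IdealSheafData} {n : ℕ} {y : Y} (h : IsTameSpecialPt g hY I n y) :
    IsPinchSpecialPt g hY I n y :=
  h.1

/-- A tame-special point is leaf-special (g13, restated). [folklore] -/
theorem isLeafSpecialPt_of_isTameSpecialPt {k : Type} [Field k] {Y : Scheme.{0}} {g : Y ⟶ Spec (.of k)}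
    {hY : Scheme.IsRegular Y} {I : Y.IdealSheafData} {n : ℕ} {y : Y} (h : IsTameSpecialPt g hY I n y) :
    IsLeafSpecialPt g hY I n y :=
  h.1.1

/-- A tame-special point is relatively special (g12). [folklore] -/
theorem isRelSpecialPt_of_isTameSpecialPt {k : Type} [Field k] {Y : Scheme.{0}} {g : Y ⟶ Spec (.of k)}
    {hY : Scheme.IsRegular Y} {I : Y.IdealSheafData} {n : ℕ} {y : Y} (h : IsTameSpecialPt g hY I n y) :
    IsRelSpecialPt g hY I n y :=
  h.1.1.1

/-- A tame-special point is near-special (g10, tree). [folklore] -/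
theorem isNearSpecialPt_of_isTameSpecialPt {k : Type} [Field k] {Y : Scheme.{0}} {g : Y ⟶ Spec (.of k)}
    {hY : Scheme.IsRegular Y} {I : Y.IdealSheafData} {n : ℕ} {y : Y} (h : IsTameSpecialPt g hY I n y) :
    VeryNearCutClasses.IsNearSpecialPt g hY I n y :=
  h.1.1.1.1

/-- A tame-special point is face-special (g9, tree). [folklore] -/
theorem isFaceSpecialPt_of_isTameSpecialPt {k : Type} [Field k] {Y : Scheme.{0}} {g : Y ⟶ Spec (.of k)}
    {hY : Scheme.IsRegular Y} {I : Y.IdealSheafData} {n : ℕ} {y : Y} (h : IsTameSpecialPt g hY I n y) :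
    FaceFormCutClasses.IsFaceSpecialPt g hY I n y :=
  PinchCut.isFaceSpecialPt_of_isPinchSpecialPt h.1

/-- A tame-special point is δ-special (g11, tree). [folklore] -/
theorem isDeltaSpecialPt_of_isTameSpecialPt {k : Type} [Field k] {Y : Scheme.{0}} {g : Y ⟶ Spec (.of k)}
    {hY : Scheme.IsRegular Y} {I : Y.IdealSheafData} {n : ℕ} {y : Y} (h : IsTameSpecialPt g hY I n y) :
    IsDeltaSpecialPt g hY I n y :=
  PinchCut.isDeltaSpecialPt_of_isPinchSpecialPt h.1

/-- **EXACT at each marking**: `SeqDimFour 1 n ⟺ SeqTGen n ∧ SeqTSpec n` (excluded middle on «some top point is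
tame-special»). [folklore] -/
theorem seqDimFour_one_iff : SeqDimFour 1 n ↔ SeqTGen n ∧ SeqTSpec n := by
  constructor
  · intro h
    refine ⟨?_, ?_⟩
    · intro p hp k _ _ Y g h1 h2 h3 hY h4 I hord _
      exact h p hp k Y g h1 h2 h3 hY h4 I hord (fun y _ => Or.inl le_rfl)
    · intro p hp k _ _ Y g h1 h2 h3 hY h4 I hord _
      exact h p hp k Y g h1 h2 h3 hY h4 I hord (fun y _ => Or.inl le_rfl)
  · rintro ⟨hG, hS⟩ p hp k _ _ Y g h1 h2 h3 hY h4 I hord _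
    by_cases hex : ∃ y : Y, idealOrder I y = ((n : ℕ) : ℕ∞) ∧ IsTameSpecialPt g hY I n y
    · exact hS p hp k Y g h1 h2 h3 hY h4 I hord hex
    · refine hG p hp k Y g h1 h2 h3 hY h4 I hord ?_
      intro y hy
      rcases classGE_or_gen_or_tspecial g hY I n y with h | h
      · exact h
      · exact absurd ⟨y, hy, h⟩ hex

/-- The two classes at one marking give all data. [folklore] -/
theorem seqDimFour_one_of_tgen_tspec (hG : SeqTGen n) (hS : SeqTSpec n) : SeqDimFour 1 n :=
  seqDimFour_one_iff.mpr ⟨hG, hS⟩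

/-- `SeqTGen n` is `SeqDimFour 1 n` restricted: weaker BY LETTER. [folklore] -/
theorem seqTGen_of_seqDimFour_one (h : SeqDimFour 1 n) : SeqTGen n := (seqDimFour_one_iff.mp h).1

/-- `SeqTSpec n` is `SeqDimFour 1 n` restricted: weaker BY LETTER. [folklore] -/
theorem seqTSpec_of_seqDimFour_one (h : SeqDimFour 1 n) : SeqTSpec n := (seqDimFour_one_iff.mp h).2

/-- `SeqDimFour 2 n` is `SeqTGen n` restricted. [folklore] -/
theorem seqDimFour_two_of_seqTGen (h : SeqTGen n) : SeqDimFour 2 n := by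
  intro p hp k _ _ Y g h1 h2 h3 hY h4 I hord hcls
  exact h p hp k Y g h1 h2 h3 hY h4 I hord (fun y hy => Or.inl (hcls y hy))

/-- g14's decided schema `SeqPGen n` (restated) is `SeqTGen n` restricted (the jet leaf ENLARGES the decided class).
[folklore] -/
theorem seqPGen_of_seqTGen (h : SeqTGen n) : SeqPGen n := by
  intro p hp k _ _ Y g h1 h2 h3 hY h4 I hord hcls
  refine h p hp k Y g h1 h2 h3 hY h4 I hord ?_
  intro y hy
  rcases hcls y hy with h' | h' | h' | h' | h' | h' | h' | h'
  · exact Or.inl h'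
  · exact Or.inr (Or.inl h')
  · exact Or.inr (Or.inr (Or.inl h'))
  · exact Or.inr (Or.inr (Or.inr (Or.inl h')))
  · exact Or.inr (Or.inr (Or.inr (Or.inr (Or.inl h'))))
  · exact Or.inr (Or.inr (Or.inr (Or.inr (Or.inr (Or.inl h')))))
  · exact Or.inr (Or.inr (Or.inr (Or.inr (Or.inr (Or.inr (Or.inl h'))))))
  · exact Or.inr (Or.inr (Or.inr (Or.inr (Or.inr (Or.inr (Or.inr (Or.inl h')))))))

/-- g13's decided schema `SeqLGen n` (restated) is `SeqTGen n` restricted. [folklore] -/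
theorem seqLGen_of_seqTGen (h : SeqTGen n) : SeqLGen n :=
  PinchCut.seqLGen_of_seqPGen (seqPGen_of_seqTGen h)

/-- g12's decided schema `SeqRGen n` (restated; tree `RelativeDeltaCutClasses`) is `SeqTGen n` restricted. [folklore] -/
theorem seqRGen_of_seqTGen (h : SeqTGen n) : SeqRGen n :=
  PinchCut.seqRGen_of_seqPGen (seqPGen_of_seqTGen h)

/-- g10's decided schema `SeqNGen n` (tree) is `SeqTGen n` restricted. [folklore] -/
theorem seqNGen_of_seqTGen (h : SeqTGen n) : VeryNearCutClasses.SeqNGen n :=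
  PinchCut.seqNGen_of_seqPGen (seqPGen_of_seqTGen h)

/-- g11's decided schema `SeqDGen n` (tree) is `SeqTGen n` restricted. [folklore] -/
theorem seqDGen_of_seqTGen (h : SeqTGen n) : SeqDGen n :=
  PinchCut.seqDGen_of_seqPGen (seqPGen_of_seqTGen h)

/-- g14's located schema `SeqPSpec n` (restated) gives `SeqTSpec n` (tame-special ⇒ pinch-special): the located class
SHRINKS by letter. [folklore] -/
theorem seqTSpec_of_seqPSpec (h : SeqPSpec n) : SeqTSpec n := by
  intro p hp k _ _ Y g h1 h2 h3 hY h4 I hord hex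
  obtain ⟨y, hy, hs⟩ := hex
  exact h p hp k Y g h1 h2 h3 hY h4 I hord ⟨y, hy, hs.1⟩

/-- g13's located schema `SeqLSpec n` (restated) gives `SeqTSpec n`. [folklore] -/
theorem seqTSpec_of_seqLSpec (h : SeqLSpec n) : SeqTSpec n :=
  seqTSpec_of_seqPSpec (PinchCut.seqPSpec_of_seqLSpec h)

/-- g12's located schema `SeqRSpec n` (restated) gives `SeqTSpec n`. [folklore] -/
theorem seqTSpec_of_seqRSpec (h : SeqRSpec n) : SeqTSpec n :=
  seqTSpec_of_seqPSpec (PinchCut.seqPSpec_of_seqRSpec h)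

/-- g10's located schema `SeqNSpec n` (tree) gives `SeqTSpec n`. [folklore] -/
theorem seqTSpec_of_seqNSpec (h : VeryNearCutClasses.SeqNSpec n) : SeqTSpec n :=
  seqTSpec_of_seqPSpec (PinchCut.seqPSpec_of_seqNSpec h)

/-- g11's located schema `SeqDSpec n` (tree) gives `SeqTSpec n`. [folklore] -/
theorem seqTSpec_of_seqDSpec (h : SeqDSpec n) : SeqTSpec n :=
  seqTSpec_of_seqPSpec (PinchCut.seqPSpec_of_seqDSpec h)

/-- g14's NON-ISOLATED column gives this node's (the column SHRINKS by letter). [folklore] -/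
theorem seqTSpecNonIso_of_seqPSpecNonIso (h : SeqPSpecNonIso n) : SeqTSpecNonIso n := by
  intro p hp k _ _ Y g h1 h2 h3 hY h4 I hord hex
  obtain ⟨y, hy, hs, hni⟩ := hex
  exact h p hp k Y g h1 h2 h3 hY h4 I hord ⟨y, hy, hs.1, hni⟩

/-- g11's NON-ISOLATED column (tree) gives this node's. [folklore] -/
theorem seqTSpecNonIso_of_seqDSpecNonIso (h : SeqDSpecNonIso n) : SeqTSpecNonIso n :=
  seqTSpecNonIso_of_seqPSpecNonIso (PinchCut.seqPSpecNonIso_of_seqDSpecNonIso h)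

/-- g14's CURVE stratum gives this node's (the stratum SHRINKS by letter). [folklore] -/
theorem seqTSpecCurve_of_seqPSpecCurve (h : SeqPSpecCurve n) : SeqTSpecCurve n := by
  intro p hp k _ _ Y g h1 h2 h3 hY h4 I hord hex
  obtain ⟨y, hy, hs, hni, hcl⟩ := hex
  exact h p hp k Y g h1 h2 h3 hY h4 I hord ⟨y, hy, hs.1, hni, hcl⟩

/-- g13's CURVE stratum (restated) gives this node's (through g14's). [folklore] -/
theorem seqTSpecCurve_of_seqLSpecCurve (h : SeqLSpecCurve n) : SeqTSpecCurve n :=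
  seqTSpecCurve_of_seqPSpecCurve (PinchCut.seqPSpecCurve_of_seqLSpecCurve h)

/-- **g14's REGULAR-CENTRE cell gives this node's** — THE CELL THIS NODE CUTS SHRINKS BY LETTER (the jet-tame-curve points
leave it). [folklore] -/
theorem seqTSpecCurveReg_of_seqPSpecCurveReg (h : SeqPSpecCurveReg n) : SeqTSpecCurveReg n := by
  intro p hp k _ _ Y g h1 h2 h3 hY h4 I hord hex
  obtain ⟨y, hy, hs, hni, hreg⟩ := hex
  exact h p hp k Y g h1 h2 h3 hY h4 I hord ⟨y, hy, hs.1, hni, hreg⟩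

/-- **EXACT isolation sub-cut of the located class**: `SeqTSpec n ⟺ SeqTSpecNonIso n ∧ SeqTSpecIso n`. [folklore] -/
theorem seqTSpec_iff_iso : SeqTSpec n ↔ SeqTSpecNonIso n ∧ SeqTSpecIso n := by
  constructor
  · intro h
    refine ⟨?_, ?_⟩
    · intro p hp k _ _ Y g h1 h2 h3 hY h4 I hord hex
      obtain ⟨y, hy, hs, -⟩ := hex
      exact h p hp k Y g h1 h2 h3 hY h4 I hord ⟨y, hy, hs⟩
    · intro p hp k _ _ Y g h1 h2 h3 hY h4 I hord hex _
      exact h p hp k Y g h1 h2 h3 hY h4 I hord hex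
  · rintro ⟨hN, hI⟩ p hp k _ _ Y g h1 h2 h3 hY h4 I hord hex
    by_cases hni : ∃ y : Y, idealOrder I y = ((n : ℕ) : ℕ∞) ∧ IsTameSpecialPt g hY I n y ∧
        ¬ FaceFormCutClasses.IsIsolatedTop I n y
    · exact hN p hp k Y g h1 h2 h3 hY h4 I hord hni
    · refine hI p hp k Y g h1 h2 h3 hY h4 I hord hex ?_
      intro y hy hs
      by_contra hiso
      exact hni ⟨y, hy, hs, hiso⟩

/-- The two isolation columns give the located class (`mpr`, by name for probes). [folklore] -/
theorem seqTSpec_of_iso (hN : SeqTSpecNonIso n) (hI : SeqTSpecIso n) : SeqTSpec n :=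
  seqTSpec_iff_iso.mpr ⟨hN, hI⟩

/-- **EXACT sub-cut of the NON-ISOLATED column**: `SeqTSpecNonIso n ⟺ SeqTSpecCurve n ∧ SeqTSpecTangle n`. [folklore] -/
theorem seqTSpecNonIso_iff : SeqTSpecNonIso n ↔ SeqTSpecCurve n ∧ SeqTSpecTangle n := by
  constructor
  · intro h
    refine ⟨?_, ?_⟩
    · intro p hp k _ _ Y g h1 h2 h3 hY h4 I hord hex
      obtain ⟨y, hy, hs, hni, -⟩ := hex
      exact h p hp k Y g h1 h2 h3 hY h4 I hord ⟨y, hy, hs, hni⟩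
    · intro p hp k _ _ Y g h1 h2 h3 hY h4 I hord hex _
      exact h p hp k Y g h1 h2 h3 hY h4 I hord hex
  · rintro ⟨hC, hT⟩ p hp k _ _ Y g h1 h2 h3 hY h4 I hord hex
    by_cases hcur : ∃ y : Y, idealOrder I y = ((n : ℕ) : ℕ∞) ∧ IsTameSpecialPt g hY I n y ∧
        ¬ FaceFormCutClasses.IsIsolatedTop I n y ∧ OnCleanCurve I n y
    · exact hC p hp k Y g h1 h2 h3 hY h4 I hord hcur
    · refine hT p hp k Y g h1 h2 h3 hY h4 I hord hex ?_
      intro y hy hs hni hcl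
      exact hcur ⟨y, hy, hs, hni, hcl⟩

/-- The two strata give the non-isolated column (`mpr`, by name for probes). [folklore] -/
theorem seqTSpecNonIso_of_strata (hC : SeqTSpecCurve n) (hT : SeqTSpecTangle n) : SeqTSpecNonIso n :=
  seqTSpecNonIso_iff.mpr ⟨hC, hT⟩

/-- **EXACT sub-cut of the CURVE stratum by the REGULARITY OF THE CENTRE**: `SeqTSpecCurve n ⟺ SeqTSpecCurveReg n ∧
SeqTSpecCurveSing n`. [folklore] -/
theorem seqTSpecCurve_iff_reg : SeqTSpecCurve n ↔ SeqTSpecCurveReg n ∧ SeqTSpecCurveSing n := by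
  constructor
  · intro h
    refine ⟨?_, ?_⟩
    · intro p hp k _ _ Y g h1 h2 h3 hY h4 I hord hex
      obtain ⟨y, hy, hs, hni, hreg⟩ := hex
      exact h p hp k Y g h1 h2 h3 hY h4 I hord
        ⟨y, hy, hs, hni, PinchCut.onCleanCurve_of_onRegularCleanCurve hreg⟩
    · intro p hp k _ _ Y g h1 h2 h3 hY h4 I hord hex _
      exact h p hp k Y g h1 h2 h3 hY h4 I hord hex
  · rintro ⟨hR, hS⟩ p hp k _ _ Y g h1 h2 h3 hY h4 I hord hex
    by_cases hreg : ∃ y : Y, idealOrder I y = ((n : ℕ) : ℕ∞) ∧ IsTameSpecialPt g hY I n y ∧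
        ¬ FaceFormCutClasses.IsIsolatedTop I n y ∧ OnRegularCleanCurve I n y
    · exact hR p hp k Y g h1 h2 h3 hY h4 I hord hreg
    · refine hS p hp k Y g h1 h2 h3 hY h4 I hord hex ?_
      intro y hy hs hni _ hr
      exact hreg ⟨y, hy, hs, hni, hr⟩

/-- The two centre strata give the curve stratum (`mpr`, by name for probes). [folklore] -/
theorem seqTSpecCurve_of_centres (hR : SeqTSpecCurveReg n) (hS : SeqTSpecCurveSing n) : SeqTSpecCurve n :=
  seqTSpecCurve_iff_reg.mpr ⟨hR, hS⟩

/-- The located class from its four leaves: CURVE-REGULAR, CURVE-SINGULAR, TANGLE, ISO. [folklore] -/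
theorem seqTSpec_of_leaves (hR : SeqTSpecCurveReg n) (hS : SeqTSpecCurveSing n) (hT : SeqTSpecTangle n)
    (hI : SeqTSpecIso n) : SeqTSpec n :=
  seqTSpec_of_iso (seqTSpecNonIso_of_strata (seqTSpecCurve_of_centres hR hS) hT) hI

/-- [rev 1] Under ENGINE (T) alone, every cone-tail-curve point is a curve-exit point: the (CT) sub-class of g14's located
cell is DECIDED by the one engine and the one port (no new engine, no new port). KERNEL (PROVED). [folklore] -/
theorem isCurveExitPt_of_isConeTailCurvePt {Y : Scheme.{0}} {I : Y.IdealSheafData} {n : ℕ} {y : Y}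
    (hT : JetTameExit) (hY : Scheme.IsRegular Y) (hn : 2 ≤ n) (h : IsConeTailCurvePt I n y) :
    IsCurveExitPt I n y :=
  isCurveExitPt_of_isJetTameCurvePt hT hY hn (isJetTameCurvePt_of_isConeTailCurvePt hn h)

/-- **THE ENGINES AT WORK (pure logic given the typed pieces)**: the tree engines `VeryNearExit` (g10) and
`DeltaPackageExit` (g11), g12's `UniformCurvePackageExit`, g13's `RelCurvePackageExit` (A) and `NormalConeJumpExit` (B),
g14's `MonomialPinchExit` (M) and `FlatConeExit` (C), the NEW engine `JetTameExit` (T), and g12's engine-free port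
`CurvePackagePort n` UNCHANGED give `TGenRungAt n` for `n ≥ 2`. [folklore] -/
theorem tGenRungAt_of_engines (hV : VeryNearCutClasses.VeryNearExit) (hD : DeltaPackageExit)
    (hU : UniformCurvePackageExit) (hR : RelCurvePackageExit) (hN : NormalConeJumpExit)
    (hM : MonomialPinchExit) (hC : FlatConeExit) (hT : JetTameExit) (hP : CurvePackagePort n) (hn : 2 ≤ n) :
    TGenRungAt n := by
  intro h2 p hp k _ _ Y g hg1 hg2 hg3 hY h4 I hord hcls
  refine hP h2 p hp k Y g hg1 hg2 hg3 hY h4 I hord ?_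
  intro y hy
  rcases hcls y hy with h | h | h | h | h | h | h | h | h
  · exact Or.inl h
  · exact Or.inr (Or.inl (RelativeDeltaCut.isNearExitPt_of_isNearGenericPt hV hY hn h))
  · exact Or.inr (Or.inr (Or.inl (RelativeDeltaCut.isPackageExitPt_of_isDeltaGenericPt hD hY hn hy h)))
  · exact Or.inr (Or.inr (Or.inr (RelativeDeltaCut.isCurveExitPt_of_isCurveGenericPt hU hY hn h)))
  · exact Or.inr (Or.inr (Or.inr (CurveLeafExit.isCurveExitPt_of_isRelCurveGenericPt hR hY hn h)))
  · exact Or.inr (Or.inr (Or.inr (CurveLeafExit.isCurveExitPt_of_isFlatCurvePt hN hY hn h)))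
  · exact Or.inr (Or.inr (Or.inr (PinchCut.isCurveExitPt_of_isPinchCurvePt hM hY hn h)))
  · exact Or.inr (Or.inr (Or.inr (PinchCut.isCurveExitPt_of_isConeCurvePt hC hY hn h)))
  · exact Or.inr (Or.inr (Or.inr (isCurveExitPt_of_isJetTameCurvePt hT hY hn h)))

/-- At marking `1` every top point is a contact point (tree port `OrderOneContact`), hence of class ≥ 2: `TGenRungAt 1`
with no blow-up at all. [folklore] -/
theorem tGenRungAt_one (h1 : FaceFormCutClasses.OrderOneContact) : TGenRungAt 1 := by
  intro h2 p hp k _ _ Y g hg1 hg2 hg3 hY h4 I hord _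
  refine h2 p hp k Y g hg1 hg2 hg3 hY h4 I hord ?_
  intro y hy
  exact Or.inr (Or.inl (h1 p hp k Y g hg1 hg2 hg3 hY I y hy))

/-- **`TameGenericRung` is DECIDED modulo the typed pieces**: eight engines, g12's curve port at every marking `≥ 2`,
and the order-one contact port. [folklore] -/
theorem tameGenericRung_of_engines (hV : VeryNearCutClasses.VeryNearExit) (hD : DeltaPackageExit)
    (hU : UniformCurvePackageExit) (hR : RelCurvePackageExit) (hN : NormalConeJumpExit)
    (hM : MonomialPinchExit) (hC : FlatConeExit) (hT : JetTameExit) (hP : ∀ n : ℕ, 2 ≤ n → CurvePackagePort n)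
    (h1 : FaceFormCutClasses.OrderOneContact) : TameGenericRung := by
  intro hE2 n hn
  by_cases h : 2 ≤ n
  · exact tGenRungAt_of_engines hV hD hU hR hN hM hC hT (hP n h) h (hE2 n hn)
  · have hn1 : n = 1 := by omega
    subst hn1
    exact tGenRungAt_one h1 (hE2 1 hn)

/-- The located residual split at the rung into the two isolation columns (EXACT). [folklore] -/
theorem tameSpecialRung_iff_iso : TameSpecialRung ↔
    (E 2 → ∀ n : ℕ, 1 ≤ n → SeqTSpecNonIso n) ∧ (E 2 → ∀ n : ℕ, 1 ≤ n → SeqTSpecIso n) :=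
  ⟨fun h => ⟨fun hE2 n hn => (seqTSpec_iff_iso.mp (h hE2 n hn)).1, fun hE2 n hn => (seqTSpec_iff_iso.mp (h hE2 n hn)).2⟩,
    fun h hE2 n hn => seqTSpec_iff_iso.mpr ⟨h.1 hE2 n hn, h.2 hE2 n hn⟩⟩

/-- The located residual split at the rung into the four LEAVES (CURVE-REGULAR, CURVE-SINGULAR, TANGLE, ISO) — EXACT.
[folklore] -/
theorem tameSpecialRung_iff_leaves : TameSpecialRung ↔
    (E 2 → ∀ n : ℕ, 1 ≤ n → SeqTSpecCurveReg n) ∧ (E 2 → ∀ n : ℕ, 1 ≤ n → SeqTSpecCurveSing n) ∧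
      (E 2 → ∀ n : ℕ, 1 ≤ n → SeqTSpecTangle n) ∧ (E 2 → ∀ n : ℕ, 1 ≤ n → SeqTSpecIso n) := by
  constructor
  · intro h
    refine ⟨fun hE2 n hn => ?_, fun hE2 n hn => ?_, fun hE2 n hn => ?_,
      fun hE2 n hn => (seqTSpec_iff_iso.mp (h hE2 n hn)).2⟩
    · exact (seqTSpecCurve_iff_reg.mp (seqTSpecNonIso_iff.mp (seqTSpec_iff_iso.mp (h hE2 n hn)).1).1).1
    · exact (seqTSpecCurve_iff_reg.mp (seqTSpecNonIso_iff.mp (seqTSpec_iff_iso.mp (h hE2 n hn)).1).1).2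
    · exact (seqTSpecNonIso_iff.mp (seqTSpec_iff_iso.mp (h hE2 n hn)).1).2
  · rintro ⟨hR, hS, hT, hI⟩ hE2 n hn
    exact seqTSpec_of_leaves (hR hE2 n hn) (hS hE2 n hn) (hT hE2 n hn) (hI hE2 n hn)

/-- `E 1` ⟺ the two families at every marking (EXACT, family level). [folklore] -/
theorem e_one_iff_families : E 1 ↔ (∀ n : ℕ, 1 ≤ n → SeqTGen n) ∧ (∀ n : ℕ, 1 ≤ n → SeqTSpec n) :=
  ⟨fun h => ⟨fun n hn => seqTGen_of_seqDimFour_one (h n hn), fun n hn => seqTSpec_of_seqDimFour_one (h n hn)⟩,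
    fun h n hn => seqDimFour_one_iff.mpr ⟨h.1 n hn, h.2 n hn⟩⟩

end Kernels

end Tame

end Summit.ResolutionOfSingularities.ResolutionOfSingularities.Theorems.JetCut
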